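import Mathlib
import Summits.NavierStokesRegularity.NavierStokesRegularity.Theses.WakeRatchet
import HarnessLib

/-!
# Route `WakeRatchet`: the RATE form of the tail ratchet closes the rung with the SAME supports

Helper for the repair of the crux `TailRatchet` (stmt-NavierStokesRegularity-21808).  The crux of record
asks for an `ε₀`-UNIFORM contraction `Θ_{n+1} ≤ (1 − w(R)) Θ_n` of the tail-energy envelopes; on the DSS
stratum this is a Liouville statement (`WakeRatchetTailRatchetDSS`: delay kinematics force
`dssMu > (1+ε₀)^{-5}`), contradicted — modulo the existence of the exact fronts — by the dyadic member, whose
discretely self-similar fronts have per-shell retention `μ(ε₀) → 1` with `1 − μ ≈ (5/3)ε₀` (Kolmogorov wake;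
evidence on the item).  What the route's bookkeeping actually consumes is only a contraction STRICTLY FASTER
THAN THE a=1 SURVIVAL WEIGHT: `RatchetStarvation` needs `(1+ε₀)(1 − w) < 1`.  The natural repaired crux is
therefore the RATE RATCHET
`∀ R ≥ 1, ∃ a > 1, ∃ εs > 0, ∀ ε₀ ∈ (0, εs], … , (∀ σ, Σ_k E_{n+k}(σ) ≤ M) → ∀ σ, Σ_k E_{n+1+k}(σ) ≤ (1+ε₀)^{-a} M`
(consistent with every computed front for `a ≤ 5/3`; `a = 5/3` is Kolmogorov and sharp on the dyadic member),
and this file certifies that it closes the rung leaf with the route's three other items UNCHANGED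
(`target_of_rateRatchet`: take `w := 1 − (1+ε₀)^{-a}`, then `(1+ε₀)(1−w) = (1+ε₀)^{1−a} < 1`).
MODEL lattice only (Tao 2016 §4); nothing here is a statement about the Navier–Stokes equations, and no
summit statement is proved.
-/

noncomputable section

set_option linter.dupNamespace false

namespace Summit.NavierStokesRegularity.NavierStokesRegularity.Theorems

namespace WakeRatchetRate

open Literature.Analysis.FluidPDE Literature.Analysis.FluidPDE.TaoCascade
open Summit.NavierStokesRegularity.NavierStokesRegularity.Theses.WakeRatchet

/-- For `ε₀ > 0` and `a > 1` the rate weight beats the a=1 survival weight: with `w = 1 − (1+ε₀)^{-a}` one has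
`0 < w` and `(1+ε₀)(1 − w) < 1`. [folklore] -/
theorem rate_weight {ε₀ a : ℝ} (hε : 0 < ε₀) (ha : 1 < a) :
    0 < 1 - (1 + ε₀) ^ (-a) ∧ (1 + ε₀) * (1 - (1 - (1 + ε₀) ^ (-a))) < 1 := by
  have hb : 1 < 1 + ε₀ := by linarith
  have hb0 : 0 < 1 + ε₀ := by linarith
  constructor
  · have : (1 + ε₀) ^ (-a) < 1 := Real.rpow_lt_one_of_one_lt_of_neg hb (by linarith)
    linarith
  · have e : (1 + ε₀) * (1 - (1 - (1 + ε₀) ^ (-a))) = (1 + ε₀) ^ (1 - a) := by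
      rw [sub_sub_cancel, Real.rpow_sub hb0, Real.rpow_one, Real.rpow_neg hb0.le, div_eq_mul_inv]
    rw [e]
    exact Real.rpow_lt_one_of_one_lt_of_neg hb (by linarith)

/-- **The rate ratchet closes the rung.**  If the tail-energy envelopes of every uniformly bounded admissible
eternal solution (any covariant viscosity) of every E₂(R) table contract per shell by the RATE `(1+ε₀)^{-a}`
for some `a = a(R) > 1` below a threshold `εs(R)` — the repaired form of `TailRatchet`, quoted as the
hypothesis `hRate` — then, with the route's items `TailEnvelopeFinite`, `RatchetStarvation` and
`EternalRigidityViscBddOne` exactly as filed, the rung leaf `TaoLadderRungTwoBreak.Target` follows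
(same glue as the route's `closes`, with `w := 1 − (1+ε₀)^{-a}`).
[cite: Tao2016AveragedNS, §4 Thm. 4.2 (statement shape), §6.4; cell vocabulary] -/
theorem target_of_rateRatchet
    (hRate : ∀ R : ℝ, 1 ≤ R → ∃ a : ℝ, 1 < a ∧ ∃ εs : ℝ, 0 < εs ∧ ∀ ε₀ : ℝ, 0 < ε₀ → ε₀ ≤ εs →
      ∀ α : Fin 4 → Fin 4 → Fin 4 → ℤ × ℤ × ℤ → ℝ, InTableClass R α →
        ∀ (νh : ℝ) (W : ℤ → ℝ → Em 4), IsEternalVisc ε₀ νh α W → UniformBound W →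
          ∀ (n : ℤ) (M : ℝ), (∀ σ : ℝ, ∑' k : ℕ, physEnergy ε₀ W (n + k) σ ≤ M) →
            ∀ σ : ℝ, ∑' k : ℕ, physEnergy ε₀ W (n + 1 + k) σ ≤ (1 + ε₀) ^ (-a) * M)
    (h₂ : TailEnvelopeFinite) (h₃ : RatchetStarvation) (h₄ : EternalRigidityViscBddOne) :
    Summit.NavierStokesRegularity.NavierStokesRegularity.Theses.TaoLadderRungTwoBreak.Target := by
  intro R hR
  refine noRobustBlowupBelow_of_eternalViscBdd ?_ (h₄ R hR)
  obtain ⟨a, ha, εs, hεs, H⟩ := hRate R hR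
  refine ⟨εs, hεs, ?_⟩
  intro ε₀ hε₀ hle α hα νh W hW hU
  obtain ⟨hw, hprod⟩ := rate_weight hε₀ ha
  refine h₃ ε₀ (1 - (1 + ε₀) ^ (-a)) νh α W hε₀ hw hprod hW hU (h₂ ε₀ νh α W hε₀ hα.2.1 hW hU) ?_
  intro n M hM σ
  have h1 := H ε₀ hε₀ hle α hα νh W hW hU n M hM σ
  rwa [sub_sub_cancel]

/-- **The rate ratchet is WEAKER than the crux of record**: `TailRatchet` (uniform `w`) implies the rate
ratchet with exponent `a = 2` (threshold shrunk to `ε₀ ≤ w/2`, where `(1+ε₀)^{-2} ≥ 1 − w` because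
`(1 − w)(1 + w/2)² = 1 − ¾w² − ¼w³ ≤ 1`).  So the repair replaces the item by a consequence of it.
[cite: Tao2016AveragedNS, §4 Thm. 4.2 (statement shape); elementary] -/
theorem rateRatchet_of_tailRatchet (h : TailRatchet) :
    ∀ R : ℝ, 1 ≤ R → ∃ a : ℝ, 1 < a ∧ ∃ εs : ℝ, 0 < εs ∧ ∀ ε₀ : ℝ, 0 < ε₀ → ε₀ ≤ εs →
      ∀ α : Fin 4 → Fin 4 → Fin 4 → ℤ × ℤ × ℤ → ℝ, InTableClass R α →
        ∀ (νh : ℝ) (W : ℤ → ℝ → Em 4), IsEternalVisc ε₀ νh α W → UniformBound W →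
          ∀ (n : ℤ) (M : ℝ), (∀ σ : ℝ, ∑' k : ℕ, physEnergy ε₀ W (n + k) σ ≤ M) →
            ∀ σ : ℝ, ∑' k : ℕ, physEnergy ε₀ W (n + 1 + k) σ ≤ (1 + ε₀) ^ (-(2 : ℝ)) * M := by
  intro R hR
  obtain ⟨w, hw, εs, hεs, H⟩ := h R hR
  refine ⟨2, by norm_num, min εs (w / 2), lt_min hεs (by positivity), ?_⟩
  intro ε₀ hε₀ hle α hα νh W hW hU n M hM σ
  have hM0 : 0 ≤ M :=
    (tsum_nonneg fun k : ℕ => physEnergy_nonneg ε₀ W (n + (k : ℤ)) σ).trans (hM σ)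
  have h1 := H ε₀ hε₀ (hle.trans (min_le_left _ _)) α hα νh W hW hU n M hM σ
  refine h1.trans (mul_le_mul_of_nonneg_right ?_ hM0)
  -- `1 - w ≤ (1+ε₀)^{-2}` from `ε₀ ≤ w/2`: `(1 − w)(1 + w/2)² = 1 − ¾w² − ¼w³ ≤ 1`
  have hb0 : 0 < 1 + ε₀ := by linarith
  have hεw : ε₀ ≤ w / 2 := hle.trans (min_le_right _ _)
  have e : (1 + ε₀) ^ (-(2 : ℝ)) = ((1 + ε₀) ^ 2)⁻¹ := by
    rw [Real.rpow_neg hb0.le, show (2 : ℝ) = ((2 : ℕ) : ℝ) by norm_num, Real.rpow_natCast]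
  have hpos : 0 < (1 + ε₀) ^ 2 := by positivity
  have key : (1 - w) * (1 + ε₀) ^ 2 ≤ 1 := by
    rcases le_or_gt w 1 with hw1 | hw1
    · have hsq : (1 + ε₀) ^ 2 ≤ (1 + w / 2) ^ 2 := pow_le_pow_left₀ hb0.le (by linarith) 2
      have h2 : (1 - w) * (1 + ε₀) ^ 2 ≤ (1 - w) * (1 + w / 2) ^ 2 :=
        mul_le_mul_of_nonneg_left hsq (by linarith)
      nlinarith [sq_nonneg w, hw.le]
    · nlinarith [hpos]
  rw [e, ← one_div]
  exact (le_div_iff₀ hpos).2 key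

end WakeRatchetRate

end Summit.NavierStokesRegularity.NavierStokesRegularity.Theorems

end
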